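import Mathlib.Analysis.Complex.ExponentialBounds
import Literature.NumberTheory.Transcendental.AperyIrrationality
import Summits.KontsevichZagierPeriods.Zeta5Search.RecurrenceCertificate
import HarnessLib

/-!
# ζ(5) search — calibration of FORMAT A′: Apéry's recurrence as a `RecurrenceCertificate` (cell `pub-zeta5`, TYPER)

HONEST FRAMING: systematic search; no irrationality claim unless certified.

The FINITARY certificate `RecurrenceCertificate` (`RecurrenceCertificate.lean`) instantiated on
real data: Apéry's numbers `bₙ = q_{n,n}`, `aₙ = p_{n,n}` of the tree's Apéry table
(`Literature.NumberTheory.Transcendental.Apery.qT/pT`, after Rajkumar 2012). Ingredients, all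
PROVED here or in the tree:

* `diag_rec` — **Apéry's recurrence** `(n+2)³ y_{n+2} = (34(n+1)³+51(n+1)²+27(n+1)+5) y_{n+1} - (n+1)³ yₙ`
  on the diagonal of any Rajkumar table with an admissible boundary (from the tree's `diag_succ`
  and `super_diag`; it was not stated in the tree before);
* `diag_casoratian` — `q_{n,n} p_{n+1,n+1} - q_{n+1,n+1} p_{n,n} = 6/(n+1)³`;
* brackets `λ = 33 ≤ b_{n+1}/bₙ ≤ Λ = 34` from `N = 62` on: `λ + tₙ/λ ≤ sₙ ≤ Λ + tₙ/Λ` are cubic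
  polynomial inequalities with nonnegative coefficients after the shift `n = 62 + i`; the initial
  ratio `33 b₆₂ ≤ b₆₃` is the tree's `Apery.qT_diag_growth`, `b₆₃ ≤ 34 b₆₂` follows from the
  recurrence;
* integrality `bₙ ∈ ℤ`, `lcm(1..n)³ aₙ ∈ ℤ` (tree), limit `aₙ/bₙ → ζ(3)` (from the tree's
  `Apery.eps_bounds` and `b_{n,n} ≥ n+1`), and the multiplicative margin `e³ · 34 · 1 < 33²`
  (`Real.exp_one_lt_d9`).

Outcome: `aperyRecurrenceCertificate : RecurrenceCertificate (zetaValue 3)` and, by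
`RecurrenceCertificate.irrational`, an `example : Irrational (zetaValue 3)` (the tree's
`Apery.irrational_zeta_three`, re-derived through FORMAT A; examples are not declarations). In the
cell's units: `η = 2 log 33 − log 34 − 0 − 3 = 0.4665…` (true margin `4 log(1+√2) − 3 = 0.5255…`).
This is the template a found order-2 candidate for `ζ(5)` or `G` would follow field by field.
-/

noncomputable section

open Filter Topology Finset
open Literature.NumberTheory.Transcendental
open Literature.NumberTheory.Transcendental.Apery

namespace Summit.KontsevichZagierPeriods.Zeta5Search

namespace CalibrationAperyRecurrence

/-! ### Apéry's recurrence on the diagonal of Rajkumar's table -/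

/-- **Apéry's recurrence** on the diagonal `yₙ = u(n,n)` of a Rajkumar table with admissible
boundary: `(n+2)³ y_{n+2} = (34(n+1)³ + 51(n+1)² + 27(n+1) + 5) y_{n+1} - (n+1)³ yₙ`
(eliminate the off-diagonal entries from `diag_succ` and `super_diag`). -/
theorem diag_rec {r : ℕ → ℚ} (hr : Boundary r) (n : ℕ) :
    ((n : ℚ) + 2) ^ 3 * table r (n + 2) (n + 2) =
      (34 * ((n : ℚ) + 1) ^ 3 + 51 * ((n : ℚ) + 1) ^ 2 + 27 * ((n : ℚ) + 1) + 5) *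
          table r (n + 1) (n + 1) - ((n : ℚ) + 1) ^ 3 * table r n n := by
  have h1 := diag_succ (r := r) n
  have h2 := diag_succ (r := r) (n + 1)
  have h3 := super_diag hr n
  rw [show n + 1 + 1 = n + 2 from rfl] at h2
  linear_combination 6 * h3 + ((n : ℚ) + 2) ^ 3 * h2 + ((n : ℚ) + 1) ^ 3 * h1

/-- **Diagonal Casoratian**: `q_{n,n} p_{n+1,n+1} - q_{n+1,n+1} p_{n,n} = 6/(n+1)³`. -/
theorem diag_casoratian (n : ℕ) :
    qT n n * pT (n + 1) (n + 1) - qT (n + 1) (n + 1) * pT n n = 6 / ((n : ℚ) + 1) ^ 3 := by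
  have hq := diag_succ (r := fun _ => (1 : ℚ)) n
  have hp := diag_succ (r := H3) n
  have hc := casoratian_row n n
  unfold qT pT at *
  rw [hq, hp]
  linear_combination 6 * hc

/-- `q_{n,n} ≥ n + 1`. -/
theorem succ_le_qT_diag (n : ℕ) : (n : ℚ) + 1 ≤ qT n n := by
  rcases n with _ | i
  · simp [qT]
  · have h := succ_le_qT_succ i (i + 1)
    push_cast at h ⊢
    linarith

/-- **The limit**: `p_{n,n}/q_{n,n} → ζ(3)` (from `0 < q ζ(3) - p ≤ ζ(3)/q` and `q_{n,n} ≥ n+1`). -/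
theorem tendsto_pT_div_qT :
    Tendsto (fun n : ℕ => ((pT n n : ℚ) : ℝ) / ((qT n n : ℚ) : ℝ)) atTop (𝓝 (zetaValue 3)) := by
  have hZ := zeta_three_pos
  -- `ζ(3) - p/q = (q ζ(3) - p)/q ∈ [0, ζ(3)/(n+1)]`
  have hbound : ∀ n : ℕ, |zetaValue 3 - ((pT n n : ℚ) : ℝ) / ((qT n n : ℚ) : ℝ)| ≤
      zetaValue 3 / ((n : ℝ) + 1) := by
    intro n
    have hq := qT_pos_real n n
    obtain ⟨h0, h1⟩ := eps_bounds n
    have hqn : (n : ℝ) + 1 ≤ (qT n n : ℝ) := by exact_mod_cast succ_le_qT_diag n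
    have e : zetaValue 3 - ((pT n n : ℚ) : ℝ) / ((qT n n : ℚ) : ℝ) =
        ((qT n n : ℝ) * zetaValue 3 - pT n n) / qT n n := by
      field_simp
    rw [e, abs_of_pos (div_pos h0 hq), div_le_iff₀ hq]
    calc (qT n n : ℝ) * zetaValue 3 - pT n n ≤ zetaValue 3 / qT n n := h1
      _ ≤ zetaValue 3 / ((n : ℝ) + 1) := div_le_div_of_nonneg_left hZ.le (by positivity) hqn
      _ ≤ zetaValue 3 / ((n : ℝ) + 1) * qT n n := by
          apply le_mul_of_one_le_right (by positivity)
          exact_mod_cast one_le_qT n n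
  have hlim : Tendsto (fun n : ℕ => zetaValue 3 / ((n : ℝ) + 1)) atTop (𝓝 0) := by
    have h := tendsto_const_div_atTop_nhds_zero_nat (zetaValue 3)
    exact (h.comp (tendsto_add_atTop_nat 1)).congr fun n => by
      simp only [Function.comp_apply, Nat.cast_add, Nat.cast_one]
  rw [← tendsto_sub_nhds_zero_iff]
  refine squeeze_zero_norm (fun n => ?_) hlim
  rw [Real.norm_eq_abs, abs_sub_comm]
  exact hbound n

/-! ### The certificate -/

/-- The recurrence coefficient `sₙ = (34(n+1)³ + 51(n+1)² + 27(n+1) + 5)/(n+2)³`. -/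
def sApery (n : ℕ) : ℚ :=
  (34 * ((n : ℚ) + 1) ^ 3 + 51 * ((n : ℚ) + 1) ^ 2 + 27 * ((n : ℚ) + 1) + 5) / ((n : ℚ) + 2) ^ 3

/-- The recurrence coefficient `tₙ = (n+1)³/(n+2)³`. -/
def tApery (n : ℕ) : ℚ := ((n : ℚ) + 1) ^ 3 / ((n : ℚ) + 2) ^ 3

/-- The diagonal of a Rajkumar table solves `y (n+2) = sₙ y (n+1) - tₙ yₙ`. -/
theorem diag_rec' {r : ℕ → ℚ} (hr : Boundary r) (n : ℕ) :
    table r (n + 2) (n + 2) = sApery n * table r (n + 1) (n + 1) - tApery n * table r n n := by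
  have h := diag_rec hr n
  have hn : ((n : ℚ) + 2) ^ 3 ≠ 0 := by positivity
  unfold sApery tApery
  field_simp
  linear_combination h

/-- **Apéry's numbers as a `RecurrenceCertificate` for `ζ(3)`** (FORMAT A′ calibration):
`u = q_{n,n}`, `v = p_{n,n}`, brackets `[33, 34]` from `N = 62`, `τ = 1`, `D n = lcm(1..n)³`,
margin `e³ · 34 · 1 < 33²`. -/
def aperyRecurrenceCertificate : RecurrenceCertificate (zetaValue 3) where
  u n := qT n n
  v n := pT n n
  s := sApery
  t := tApery
  N := 62
  lam := 33
  Lam := 34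
  tau := 1
  m := 1
  c := ![1]
  k := ![3]
  rec_u n _ := diag_rec' boundary_one n
  rec_v n _ := diag_rec' boundary_H3 n
  one_lt_lam := by norm_num
  lam_le := by norm_num
  t_pos n _ := by unfold tApery; positivity
  t_le n _ := by
    unfold tApery
    rw [div_le_one (by positivity)]
    gcongr; norm_num
  low n hn := by
    obtain ⟨i, rfl⟩ : ∃ i, n = i + 62 := ⟨n - 62, by omega⟩
    have key : sApery (i + 62) - (33 + tApery (i + 62) / 33) =
        (32 * (i : ℚ) ^ 3 + 4464 * (i : ℚ) ^ 2 + 179064 * (i : ℚ) + 1563996) /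
          (33 * (((i : ℚ) + 62) + 2) ^ 3) := by
      unfold sApery tApery
      push_cast
      field_simp
      ring
    have hnum : (0 : ℚ) ≤ (32 * (i : ℚ) ^ 3 + 4464 * (i : ℚ) ^ 2 + 179064 * (i : ℚ) + 1563996) /
        (33 * (((i : ℚ) + 62) + 2) ^ 3) := by positivity
    linarith
  up n _ := by
    have key : (34 + tApery n / 34) - sApery n =
        ((n : ℚ) ^ 3 + 1737 * (n : ℚ) ^ 2 + 6021 * (n : ℚ) + 5271) / (34 * ((n : ℚ) + 2) ^ 3) := by
      unfold sApery tApery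
      field_simp
      ring
    have hnum : (0 : ℚ) ≤ ((n : ℚ) ^ 3 + 1737 * (n : ℚ) ^ 2 + 6021 * (n : ℚ) + 5271) /
        (34 * ((n : ℚ) + 2) ^ 3) := by positivity
    linarith
  u_pos := qT_pos 62 62
  init_low := by
    have h := qT_diag_growth (k := 61) le_rfl
    simpa using h
  init_up := by
    have h := diag_rec boundary_one 61
    have h0 : (0 : ℚ) ≤ table (fun _ => 1) 61 61 := (qT_pos 61 61).le
    have h1 : (0 : ℚ) ≤ table (fun _ => 1) 62 62 := (qT_pos 62 62).le
    change table (fun _ => (1 : ℚ)) (62 + 1) (62 + 1) ≤ 34 * table (fun _ => (1 : ℚ)) 62 62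
    norm_num at h ⊢
    linarith
  casorati_init := by
    rw [diag_casoratian 62]; positivity
  isInt_u n _ := by
    obtain ⟨z, hz⟩ := qT_isInt n n
    refine ⟨(Nat.lcmUpto n : ℤ) ^ 3 * z, ?_⟩
    simp only [Fin.prod_univ_one, Matrix.cons_val_zero, one_mul]
    rw [hz]; push_cast; ring
  isInt_v n _ := by
    obtain ⟨z, hz⟩ := lcmUpto_cube_mul_pT_isInt n n n le_rfl le_rfl
    refine ⟨z, ?_⟩
    simp only [Fin.prod_univ_one, Matrix.cons_val_zero, one_mul]
    push_cast
    exact hz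
  tendsto_div := tendsto_pT_div_qT
  margin := by
    simp only [Fin.sum_univ_one, Matrix.cons_val_zero]
    have h1 := Real.exp_one_lt_d9
    have h0 := (Real.exp_pos 1).le
    have h3 : Real.exp 1 ^ 3 < 21 :=
      lt_trans (pow_lt_pow_left₀ h1 h0 three_ne_zero) (by norm_num)
    have e : Real.exp (((1 * 3 : ℕ) : ℕ) : ℝ) = Real.exp 1 ^ 3 := by
      rw [Real.exp_one_pow]
    rw [e]
    push_cast
    linarith

/-- The one-line use: `ζ(3) ∉ ℚ` through FORMAT A′ (an `example`; the statement is the tree's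
`Apery.irrational_zeta_three`). -/
example : Irrational (zetaValue 3) := aperyRecurrenceCertificate.irrational

end CalibrationAperyRecurrence

end Summit.KontsevichZagierPeriods.Zeta5Search
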